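import Literature.Analysis.FluidPDE.FluidComputer.ThresholdLevelTable
import HarnessLib

/-!
# Kernel run of the level-table checker, chunks 12 … 15 (steps 300 … 399) (bp3 gen 13, layer 4)

HONEST FRAMING: low prior, high value-of-information experiment on Tao's machine paradigm; NOT a
claim that NS blows up.

Four kernel evaluations (`decide +kernel`; no `native_decide`, no extra axioms): the checker
`runSteps` of `ThresholdLevelCheck.lean` (crude box, `K = 3` refinement passes, side and runtime
conditions, reach, speed, exit box — all in the dyadic interval arithmetic `DI` at `P = 60` with
`12` Taylor terms) runs 25 steps of `ThresholdLevelTable.stepsT` at a time, from the entry box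
`Bc i` towards the next chunk's first level, and returns the entry box `Bc (i+1)` (≈ 30 s of
kernel time and bounded memory per chunk; 100-step chunks exceed the kernel's memory bound).
-/

namespace Literature.Analysis.FluidPDE.FluidComputer

namespace ThresholdLevelTable

set_option maxHeartbeats 10000000 in
set_option maxRecDepth 200000 in
/-- Chunk 12 of the table run (steps 300 … 324). [folklore] -/
theorem run12 : runSteps 60 12 3 GIt RbIt Bc12 chunk12 4525524321594313 = some Bc13 := by
  decide +kernel

set_option maxHeartbeats 10000000 in
set_option maxRecDepth 200000 in
/-- Chunk 13 of the table run (steps 325 … 349). [folklore] -/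
theorem run13 : runSteps 60 12 3 GIt RbIt Bc13 chunk13 5386115000203920 = some Bc14 := by
  decide +kernel

set_option maxHeartbeats 10000000 in
set_option maxRecDepth 200000 in
/-- Chunk 14 of the table run (steps 350 … 374). [folklore] -/
theorem run14 : runSteps 60 12 3 GIt RbIt Bc14 chunk14 6410358830024270 = some Bc15 := by
  decide +kernel

set_option maxHeartbeats 10000000 in
set_option maxRecDepth 200000 in
/-- Chunk 15 of the table run (steps 375 … 399). [folklore] -/
theorem run15 : runSteps 60 12 3 GIt RbIt Bc15 chunk15 7629376708093743 = some Bc16 := by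
  decide +kernel

end ThresholdLevelTable

end Literature.Analysis.FluidPDE.FluidComputer
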